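import Literature.Computability.AlgebraicComplexity.InterfaceBlockCounts
import Literature.Computability.AlgebraicComplexity.LevelTriples
import HarnessLib

/-!
# Dividing the terms of an `ε`-interface tensor into regions
(Vassilevska Williams–Xu–Xu–Zhou 2024, §6.1 "Dividing into Regions", Claim 6.4) — proved

Topic `Literature/Computability/AlgebraicComplexity`.  §6.1 of Vassilevska Williams–Xu–Xu–Zhou, *New
bounds for matrix multiplication: from alpha to omega* (SODA 2024, arXiv:2307.07970): each term `t` of
the input level-`ℓ` `ε`-interface tensor is divided into three regions of sizes `A_{t,r} n_t` with
split distributions `β^{(r)}_{X,t}` subject to `∑_r A_{t,r} β^{(r)}_{X,t} = β_{X,t}` (eq. (12)), and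
every level-1 block whose portion in some region is not `ε`-consistent with that region's
distribution is zeroed out.  **Claim 6.4**: the result is (isomorphic to)
`⊗_r ⊗_t T_{i_t,j_t,k_t}^{⊗ A_{t,r} n_t}[β^{(r)}_{X,t}, β^{(r)}_{Y,t}, β^{(r)}_{Z,t}, ε]`, because the
average of `ε`-consistent portions is `ε`-consistent ("its average complete split distribution
`ξ = A₁ξ^{(1)} + A₂ξ^{(2)} + A₃ξ^{(3)}` has at most `ε` distance from `β`").

In the tree's language (`interfaceTensor K q τ L ε` on the concatenated chunk set, `InterfaceTensors.lean`)
a division into regions is a REFINEMENT `ρ : [n] → [s']` of the term map `τ : [n] → [s]` along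
`π : [s'] → [s]` (`π ∘ ρ = τ`), with a parameter list `L'` having the constituent indices of `L ∘ π` and
split distributions averaging to those of `L` with the weights `n_{t'}/n_t`.  This file PROVES:

* `card_filter_termFibre_eq_sum`, `completeSplitOn_termFibre_mul_card_eq_sum` — a coarse term is the
  disjoint union of its fine terms; split distributions average with weights `n_{t'}`;
* `splitConsistentOn_of_refinement` — **the averaging step of Claim 6.4**: `ε`-consistency on every
  (non-empty) fine term with `γ'_{t'}` implies `ε`-consistency on the coarse term with the average `γ_t`;
* `admissibleSeqs_refine_subset`, `levelBlocksX/Y/Z_refine_subset` — the level-1 blocks of the refined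
  tensor are level-1 blocks of the original one;
* `interfaceTensor_refine_eq_partSubtensor`, `vxxz2024_claim64` — **Claim 6.4**:
  `𝒯_{τ,L,ε} ≥ 𝒯_{ρ,L',ε}` (the refined tensor is the zero-out of the original keeping the blocks
  `ε`-consistent region by region; a zero-out is a restriction, hence a degeneration).  By Def. 4.1 /
  `interfaceTensor_append` the refined tensor is the tensor product over the regions.

Everything is proved; the one definition is the refined parameter list `refineTermList`; no named facts.

## References

* V. Vassilevska Williams, Y. Xu, Z. Xu, R. Zhou, *New bounds for matrix multiplication: from alpha
  to omega*, SODA 2024, arXiv:2307.07970 (held: `paper:arxiv-2307.07970`), §6.1 (eq. (12)) and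
  Claim 6.4; §5.1 for the global stage. [VassilevskaWilliamsXuXuZhou2024]
-/

noncomputable section

open scoped BigOperators
open Finset

namespace Literature.Computability.AlgebraicComplexity

open Literature.Barriers.MatrixMultiplication (bigCwTensor)

universe u

/-! ## Coarse terms as unions of fine terms -/

section Fibres

variable {c n s s' : ℕ} (τ : Fin n → Fin s) (ρ : Fin n → Fin s') (π : Fin s' → Fin s)

/-- **A coarse term is the disjoint union of its fine terms**, counted with any predicate:
`#{u ∈ τ⁻¹(t) | p u} = ∑_{t' : π t' = t} #{u ∈ ρ⁻¹(t') | p u}`. [cite: VassilevskaWilliamsXuXuZhou2024, §6.1 (regions of a term)] -/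
theorem card_filter_termFibre_eq_sum (hπ : ∀ u, π (ρ u) = τ u) (t : Fin s) (p : Fin n → Prop) [DecidablePred p] :
    ((termFibre τ t).filter p).card = ∑ t' ∈ univ.filter (fun t' => π t' = t), ((termFibre ρ t').filter p).card := by
  rw [card_eq_sum_card_fiberwise (f := ρ) (s := (termFibre τ t).filter p) (t := univ.filter fun t' => π t' = t)]
  · refine sum_congr rfl fun t' ht' => ?_
    congr 1
    ext u
    simp only [mem_filter, mem_univ, true_and, termFibre]
    obtain ⟨-, hπt⟩ := mem_filter.1 ht'
    constructor
    · rintro ⟨⟨-, hp⟩, hu⟩; exact ⟨hu, hp⟩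
    · rintro ⟨hu, hp⟩; exact ⟨⟨by rw [← hπ u, hu, hπt], hp⟩, hu⟩
  · intro u hu
    rw [mem_coe, mem_filter] at hu
    obtain ⟨hu, -⟩ := hu
    simp only [termFibre, mem_filter, mem_univ, true_and] at hu
    simp only [coe_filter, Set.mem_setOf_eq, mem_univ, true_and]
    rw [hπ, hu]

/-- Sizes: `n_t = ∑_{t' : π t' = t} n_{t'}`. [cite: VassilevskaWilliamsXuXuZhou2024, §6.1 (A_{t,1}n_t + A_{t,2}n_t + A_{t,3}n_t = n_t)] -/
theorem card_termFibre_eq_sum (hπ : ∀ u, π (ρ u) = τ u) (t : Fin s) :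
    (termFibre τ t).card = ∑ t' ∈ univ.filter (fun t' => π t' = t), (termFibre ρ t').card := by
  have := card_filter_termFibre_eq_sum τ ρ π hπ t (fun _ => True)
  simpa using this

/-- **Split distributions average**: `split(Î, τ⁻¹t)(σ) · n_t = ∑_{t'} split(Î, ρ⁻¹t')(σ) · n_{t'}`.
[cite: VassilevskaWilliamsXuXuZhou2024, Claim 6.4 (proof: "its average complete split distribution")] -/
theorem completeSplitOn_termFibre_mul_card_eq_sum (hπ : ∀ u, π (ρ u) = τ u) (I : Fin n → Fin c → Fin 3) (t : Fin s)
    (σ : Fin c → Fin 3) :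
    completeSplitOn I (termFibre τ t) σ * (termFibre τ t).card =
      ∑ t' ∈ univ.filter (fun t' => π t' = t), completeSplitOn I (termFibre ρ t') σ * (termFibre ρ t').card := by
  rw [completeSplitOn_mul_card, card_filter_termFibre_eq_sum τ ρ π hπ t]
  push_cast
  exact sum_congr rfl fun t' _ => (completeSplitOn_mul_card I _ σ).symm

/-- **The averaging step of Claim 6.4**: if `Î` is `ε`-consistent with `γ'_{t'}` on every non-empty fine
term `t'` of the coarse term `t`, and `γ_t` is the `n_{t'}/n_t`-weighted average of the `γ'_{t'}`, then
`Î` is `ε`-consistent with `γ_t` on the coarse term. [cite: VassilevskaWilliamsXuXuZhou2024, Claim 6.4 (proof)] -/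
theorem splitConsistentOn_of_refinement (hπ : ∀ u, π (ρ u) = τ u) {I : Fin n → Fin c → Fin 3} {t : Fin s}
    {γ : (Fin c → Fin 3) → ℝ} {γ' : Fin s' → (Fin c → Fin 3) → ℝ} {ε : ℝ}
    (havg : ∀ σ, γ σ * (termFibre τ t).card = ∑ t' ∈ univ.filter (fun t' => π t' = t), ((termFibre ρ t').card : ℝ) * γ' t' σ)
    (hfine : ∀ t', π t' = t → (termFibre ρ t').Nonempty → SplitConsistentOn ε (γ' t') I (termFibre ρ t'))
    (hne : (termFibre τ t).Nonempty) : SplitConsistentOn ε γ I (termFibre τ t) := by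
  intro σ
  set F := univ.filter (fun t' => π t' = t) with hF
  have hTpos : (0 : ℝ) < (termFibre τ t).card := by exact_mod_cast hne.card_pos
  have hcard : ((termFibre τ t).card : ℝ) = ∑ t' ∈ F, ((termFibre ρ t').card : ℝ) := by
    rw [card_termFibre_eq_sum τ ρ π hπ t]; push_cast; rfl
  have hdiff : (completeSplitOn I (termFibre τ t) σ - γ σ) * (termFibre τ t).card =
      ∑ t' ∈ F, ((termFibre ρ t').card : ℝ) * (completeSplitOn I (termFibre ρ t') σ - γ' t' σ) := by
    rw [sub_mul, completeSplitOn_termFibre_mul_card_eq_sum τ ρ π hπ I t σ, havg σ, ← sum_sub_distrib]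
    refine sum_congr rfl fun t' _ => ?_; ring
  have habs : |completeSplitOn I (termFibre τ t) σ - γ σ| * (termFibre τ t).card ≤ ε * (termFibre τ t).card := by
    rw [← abs_of_pos hTpos, ← abs_mul, hdiff, abs_of_pos hTpos, hcard, mul_sum]
    refine (abs_sum_le_sum_abs _ _).trans (sum_le_sum fun t' ht' => ?_)
    have hπt : π t' = t := (mem_filter.1 ht').2
    rcases (termFibre ρ t').eq_empty_or_nonempty with h0 | hne'
    · rw [h0, card_empty, Nat.cast_zero, zero_mul, abs_zero, mul_zero]
    · rw [abs_mul, abs_of_nonneg (Nat.cast_nonneg _), mul_comm]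
      exact mul_le_mul_of_nonneg_right (hfine t' hπt hne' σ) (Nat.cast_nonneg _)
  exact le_of_mul_le_mul_right habs hTpos

end Fibres

/-! ## The refined parameter list and Claim 6.4 -/

section Refine

variable {c n s s' : ℕ}

/-- **The refined parameter list**: the fine term `t'` has the constituent indices of its coarse term
`π t'` and its own split distributions `γ'_X(t'), γ'_Y(t'), γ'_Z(t')` (the `β^{(r)}_{W,t}` of the
regions). [cite: VassilevskaWilliamsXuXuZhou2024, §6.1 (β^{(r)}_{X,t}) and Claim 6.4] -/
def refineTermList (π : Fin s' → Fin s) (L : Fin s → InterfaceTerm c)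
    (γX' γY' γZ' : Fin s' → (Fin c → Fin 3) → ℝ) : Fin s' → InterfaceTerm c :=
  fun t' => ⟨(L (π t')).i, (L (π t')).j, (L (π t')).k, γX' t', γY' t', γZ' t'⟩

variable (τ : Fin n → Fin s) (ρ : Fin n → Fin s') (π : Fin s' → Fin s)

/-- **Admissible for the refinement ⇒ admissible** (levels agree along `π`; consistency by averaging).
[cite: VassilevskaWilliamsXuXuZhou2024, Claim 6.4 (proof)] -/
theorem admissibleSeqs_refine_subset (hπ : ∀ u, π (ρ u) = τ u) (deg : Fin s → ℕ) {γ : Fin s → (Fin c → Fin 3) → ℝ}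
    {γ' : Fin s' → (Fin c → Fin 3) → ℝ} {ε : ℝ}
    (havg : ∀ t σ, γ t σ * (termFibre τ t).card = ∑ t' ∈ univ.filter (fun t' => π t' = t), ((termFibre ρ t').card : ℝ) * γ' t' σ) :
    admissibleSeqs ρ (fun t' => deg (π t')) γ' ε ⊆ admissibleSeqs τ deg γ ε := by
  intro I hI
  rw [mem_admissibleSeqs] at hI ⊢
  obtain ⟨hlev, hcons⟩ := hI
  refine ⟨fun u => by rw [hlev u, hπ u], fun t hne => ?_⟩
  exact splitConsistentOn_of_refinement τ ρ π hπ (havg t) (fun t' _ hne' => hcons t' hne') hne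

/-- The level-1 `X`-blocks of the refined tensor are level-1 `X`-blocks of the original. [cite: VassilevskaWilliamsXuXuZhou2024, Claim 6.4] -/
theorem levelBlocksX_refine_subset (hπ : ∀ u, π (ρ u) = τ u) (L : Fin s → InterfaceTerm c)
    {γX' γY' γZ' : Fin s' → (Fin c → Fin 3) → ℝ} {ε : ℝ}
    (havgX : ∀ t σ, (L t).γX σ * (termFibre τ t).card = ∑ t' ∈ univ.filter (fun t' => π t' = t), ((termFibre ρ t').card : ℝ) * γX' t' σ) :
    levelBlocksX ρ (refineTermList π L γX' γY' γZ') ε ⊆ levelBlocksX τ L ε :=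
  admissibleSeqs_refine_subset τ ρ π hπ (fun t => (L t).i) havgX

/-- The level-1 `Y`-blocks of the refined tensor are level-1 `Y`-blocks of the original. [cite: VassilevskaWilliamsXuXuZhou2024, Claim 6.4] -/
theorem levelBlocksY_refine_subset (hπ : ∀ u, π (ρ u) = τ u) (L : Fin s → InterfaceTerm c)
    {γX' γY' γZ' : Fin s' → (Fin c → Fin 3) → ℝ} {ε : ℝ}
    (havgY : ∀ t σ, (L t).γY σ * (termFibre τ t).card = ∑ t' ∈ univ.filter (fun t' => π t' = t), ((termFibre ρ t').card : ℝ) * γY' t' σ) :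
    levelBlocksY ρ (refineTermList π L γX' γY' γZ') ε ⊆ levelBlocksY τ L ε :=
  admissibleSeqs_refine_subset τ ρ π hπ (fun t => (L t).j) havgY

/-- The level-1 `Z`-blocks of the refined tensor are level-1 `Z`-blocks of the original. [cite: VassilevskaWilliamsXuXuZhou2024, Claim 6.4] -/
theorem levelBlocksZ_refine_subset (hπ : ∀ u, π (ρ u) = τ u) (L : Fin s → InterfaceTerm c)
    {γX' γY' γZ' : Fin s' → (Fin c → Fin 3) → ℝ} {ε : ℝ}
    (havgZ : ∀ t σ, (L t).γZ σ * (termFibre τ t).card = ∑ t' ∈ univ.filter (fun t' => π t' = t), ((termFibre ρ t').card : ℝ) * γZ' t' σ) :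
    levelBlocksZ ρ (refineTermList π L γX' γY' γZ') ε ⊆ levelBlocksZ τ L ε :=
  admissibleSeqs_refine_subset τ ρ π hπ (fun t => (L t).k) havgZ

variable (K : Type u) [CommSemiring K] (q : ℕ)

/-- **The refined tensor is the zero-out of the original** keeping the blocks that are `ε`-consistent
region by region. [cite: VassilevskaWilliamsXuXuZhou2024, §6.1 ("if the portion of it in the r-th region … is not ε-approximate consistent … we zero it out")] -/
theorem interfaceTensor_refine_eq_partSubtensor (hπ : ∀ u, π (ρ u) = τ u) (L : Fin s → InterfaceTerm c)
    {γX' γY' γZ' : Fin s' → (Fin c → Fin 3) → ℝ} {ε : ℝ}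
    (havgX : ∀ t σ, (L t).γX σ * (termFibre τ t).card = ∑ t' ∈ univ.filter (fun t' => π t' = t), ((termFibre ρ t').card : ℝ) * γX' t' σ)
    (havgY : ∀ t σ, (L t).γY σ * (termFibre τ t).card = ∑ t' ∈ univ.filter (fun t' => π t' = t), ((termFibre ρ t').card : ℝ) * γY' t' σ)
    (havgZ : ∀ t σ, (L t).γZ σ * (termFibre τ t).card = ∑ t' ∈ univ.filter (fun t' => π t' = t), ((termFibre ρ t').card : ℝ) * γZ' t' σ) :
    interfaceTensor K q ρ (refineTermList π L γX' γY' γZ') ε =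
      partSubtensor levelSeq levelSeq levelSeq (interfaceTensor K q τ L ε)
        (levelBlocksX ρ (refineTermList π L γX' γY' γZ') ε) (levelBlocksY ρ (refineTermList π L γX' γY' γZ') ε)
        (levelBlocksZ ρ (refineTermList π L γX' γY' γZ') ε) := by
  rw [interfaceTensor, interfaceTensor, partSubtensor_partSubtensor,
    inter_eq_right.2 (levelBlocksX_refine_subset τ ρ π hπ L havgX),
    inter_eq_right.2 (levelBlocksY_refine_subset τ ρ π hπ L havgY),
    inter_eq_right.2 (levelBlocksZ_refine_subset τ ρ π hπ L havgZ)]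

/-- **VXXZ Claim 6.4 (dividing the terms of an `ε`-interface tensor into regions)**: for a refinement
`ρ` of the term map `τ` along `π` and split distributions `γ'` on the fine terms averaging (with the
weights `n_{t'}/n_t`, i.e. `∑_r A_{t,r} β^{(r)}_{W,t} = β_{W,t}`) to those of `L`,
`𝒯_{τ,L,ε} ≥ 𝒯_{ρ,L',ε}` — the input `ε`-interface tensor degenerates (by a zero-out) to the
`ε`-interface tensor with the refined parameter list, `= ⊗_r ⊗_t T_{i_t,j_t,k_t}^{⊗A_{t,r}n_t}[β^{(r)}, ε]`.
[cite: VassilevskaWilliamsXuXuZhou2024, Claim 6.4] -/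
theorem vxxz2024_claim64 (hπ : ∀ u, π (ρ u) = τ u) (L : Fin s → InterfaceTerm c)
    {γX' γY' γZ' : Fin s' → (Fin c → Fin 3) → ℝ} (ε : ℝ)
    (havgX : ∀ t σ, (L t).γX σ * (termFibre τ t).card = ∑ t' ∈ univ.filter (fun t' => π t' = t), ((termFibre ρ t').card : ℝ) * γX' t' σ)
    (havgY : ∀ t σ, (L t).γY σ * (termFibre τ t).card = ∑ t' ∈ univ.filter (fun t' => π t' = t), ((termFibre ρ t').card : ℝ) * γY' t' σ)
    (havgZ : ∀ t σ, (L t).γZ σ * (termFibre τ t).card = ∑ t' ∈ univ.filter (fun t' => π t' = t), ((termFibre ρ t').card : ℝ) * γZ' t' σ) :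
    TensorRestrictsTo (interfaceTensor K q τ L ε) (interfaceTensor K q ρ (refineTermList π L γX' γY' γZ') ε) := by
  rw [interfaceTensor_refine_eq_partSubtensor τ ρ π K q hπ L havgX havgY havgZ]
  exact tensorRestrictsTo_partSubtensor _ _ _ _ _ _ _

/-- The same for `k` independent copies. [cite: VassilevskaWilliamsXuXuZhou2024, Claim 6.4] -/
theorem vxxz2024_claim64_copies (hπ : ∀ u, π (ρ u) = τ u) (L : Fin s → InterfaceTerm c)
    {γX' γY' γZ' : Fin s' → (Fin c → Fin 3) → ℝ} (ε : ℝ) (k : ℕ)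
    (havgX : ∀ t σ, (L t).γX σ * (termFibre τ t).card = ∑ t' ∈ univ.filter (fun t' => π t' = t), ((termFibre ρ t').card : ℝ) * γX' t' σ)
    (havgY : ∀ t σ, (L t).γY σ * (termFibre τ t).card = ∑ t' ∈ univ.filter (fun t' => π t' = t), ((termFibre ρ t').card : ℝ) * γY' t' σ)
    (havgZ : ∀ t σ, (L t).γZ σ * (termFibre τ t).card = ∑ t' ∈ univ.filter (fun t' => π t' = t), ((termFibre ρ t').card : ℝ) * γZ' t' σ) :
    TensorRestrictsTo (kroneckerTensor (unitTensor K k) (interfaceTensor K q τ L ε))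
      (kroneckerTensor (unitTensor K k) (interfaceTensor K q ρ (refineTermList π L γX' γY' γZ') ε)) :=
  TensorRestrictsTo.kronecker (TensorRestrictsTo.refl _) (vxxz2024_claim64 τ ρ π K q hπ L ε havgX havgY havgZ)

end Refine

end Literature.Computability.AlgebraicComplexity
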